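/-
Copyright (c) 2026 the pub-hodgecm-mathlib formalisation cell (harness21).  Prover seat hodgecm-mathlib-F0P3-p01 (g36), Track A «(D-RAM) FOUR-FRAME» squad, helper lane on
h413 = stmt-HodgeConjecture-24833 (count-neutral).  Continuation of (β-BAL) B2b-1 (dealer∕pen LH4-plan (g13) WORD #88; SPEC-B2 v1 3227ed60 §3), PART 3.  2026-09-04.
-/
import Summits.HodgeConjecture.HodgeConjecture.Theorems.F0P3cDyRamLabelledOddOneSlotValueClass   -- ★ p860467 PART 2 (this seat): HEAD B∕C; brings ★ p860435 PART 1 (HEAD A′), ★ KappaCountEval, ★ `fibre_isCoset_zero`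
import Summits.HodgeConjecture.HodgeConjecture.Theorems.F0P3cDyRamDiagonalKappaSplitCountEval      -- ★ `chiVec_zero ∕ _one ∕ _two`, `normSign_mul_self`
import HarnessLib

/-!
# Crux `H413`, line LH4 «(D-RAM) FOUR-FRAME» — (β-BAL) B2b-1 PART 3 «THE ONE-SLOT LABELLED COUNT IS HALF A κ-COUNT OF THE THIRD SLOT»

Cell `hodgecm-mathlib` (D-0151), FLOOR 0, crux item H413 = `stmt-HodgeConjecture-24833`, route `HCCMUnconditional`; squad F0∕P3c∕LH4.  THEOREMS ONLY (no `def`, no instance, no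
notation, no `sorry`, default heartbeats); ★-only imports; lane `--supports stmt-HodgeConjecture-24833 --as helper` (count-neutral); pays NO row, states NO law.

THE MATHEMATICS.  ★ PART 1 `labelledOddCount_div_relIndex_eq_of_oneSlot`: on an orbit whose type-`tv` polarisations form `D₁·S_F(M₀)` and whose label is ONE-SLOT at slot `k`
(`Λ M₀ (D₁·u) ↔ ε·ω(u_k) = 1`), `m^Λ_i(M₀)∕[𝒰 : N(S̃′(M₀))] = ε·ω(D_{1,i})∕2 · [∀ u ∈ S_F, ω(u_i)·ω(u_k) = 1] · stabiliserWeight σ M₀`.  For `i ≠ k` and `m` the THIRD slot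
(`{i, k, m} = {0, 1, 2}`) the pair indicator IS the κ-character of slot `m`: `ω(u_i)·ω(u_k) = chiVec σ m u` (★ `chiVec` = `Π_{j ≠ m} ω(u_j)`), and by ★ `kappaCount_eq_cosetKappa_of_hcoset` +
★ `cosetKappa_coset_eq_of_dichotomy` the UNLABELLED κ-count of the same orbit is `kappaCount σ ϖ tv m M₀ = [∀ u ∈ S_F, χ_m(u) = 1]·χ_m(D₁)` with `χ_m(D₁) = ω(D_{1,i})·ω(D_{1,k})`.
Hence (`ω(D_{1,k})² = 1`):
* §1 `chiVec_eq_normSign_mul_normSign_of_ne` (the three-slot bookkeeping), `kappaCount_eq_ite_of_hcoset` (the unlabelled κ-count of a one-coset orbit, by name).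
* §2 HEAD (κ1) **`labelledOddCount_div_relIndex_eq_kappaCount_mul_of_oneSlot`** (`i ≠ k`): `m^Λ_i(M₀)∕[𝒰 : N S̃′] = ε·ω(D_{1,k})∕2 · kappaCount σ ϖ tv m M₀ · stabiliserWeight σ M₀`
  — the labelled term is HALF the L-sign `ε·ω(D_{1,k})` times the unlabelled κ-term of the third slot; (κ2) **`labelledOddCount_div_relIndex_eq_of_oneSlot_same`** (`i = k`):
  `m^Λ_k(M₀)∕[𝒰 : N S̃′] = ε·ω(D_{1,k})∕2 · stabiliserWeight σ M₀` (no κ-factor on the read slot).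
* §3 (κ3)∕(κ4) the `valueClassLabel` instances (type `0`, `M₀ = latt g` normalised, slot `1` resp. `0` negligible, `ε = ω(e′)` of ★ PART 2 HEAD B).
So a one-slot-dominant STRATUM with constant L-sign contributes `½·ε·ω(D_{1,k}) × ‹the ★ unlabelled κ_m census of the stratum›` to slot `i ∉ {k}` of the (β-BAL) table and
`½·ε·ω(D_{1,k}) × Σ stabiliserWeight` to slot `k` — the Stage-B bricks of the κ-road (★ `…DiagonalKappa*Stratum*`, `…LabelledKappa*`) are reusable BY NAME.
HONEST LABEL.  Count-neutral helper; proves no census: the eightfold vanishing, (β-BAL), (A″), (β), T₊ OPEN; `HC_CM` is proved only modulo the 7 printed citations (2 remaining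
named inputs: hLiu418 = `stmt-HodgeConjecture-24832`, h413 = `stmt-HodgeConjecture-24833`) until rung 0 closes.

## References
* [Kottwitz1986BaseChangeUnits] R. E. Kottwitz, *Base change for unit elements of Hecke algebras*, Compositio Math. 60 (1986), §1 pp. 240–241.
* [Rogawski1990] J. D. Rogawski, *Automorphic Representations of Unitary Groups in Three Variables*, Ann. of Math. Stud. 123 (1990), §4.9 Prop. 4.9.1 (a)(b) p. 55, §4.10 p. 58.
* [LanglandsShelstad1987] R. P. Langlands, D. Shelstad, *On the definition of transfer factors*, Math. Ann. 278 (1987), §3 (the three κ of `(ℤ∕2)³`).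
* [Serre1979] J.-P. Serre, *Local Fields*, GTM 67 (1979), Ch. V §3 Cor. 3.
-/

set_option autoImplicit false

noncomputable section

namespace Summit.HodgeConjecture.HodgeConjecture.Cruxes.H413.F0P3cDyRamLabelledOddOneSlotKappa

open Literature.NumberTheory.Automorphic Literature.NumberTheory.Automorphic.HermitianLattice
open Literature.NumberTheory.Automorphic.UnitaryLatticeTree Literature.NumberTheory.Automorphic.UnitaryThreeFourFrame
open Summit.HodgeConjecture.HodgeConjecture.Cruxes.H413.F0P3cDyRamFourFramePieces
open Summit.HodgeConjecture.HodgeConjecture.Cruxes.H413.F0P3cDyRamDiagonalTorusDefs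
open Summit.HodgeConjecture.HodgeConjecture.Cruxes.H413.F0P3cDyRamDiagonalKappaCountDefs
open Summit.HodgeConjecture.HodgeConjecture.Cruxes.H413.F0P3cDyRamLabelledOddCountDefs
open Summit.HodgeConjecture.HodgeConjecture.Cruxes.H413.F0P3cDyRamDiagonalOrbitFibreTransport
open Summit.HodgeConjecture.HodgeConjecture.Cruxes.H413.F0P3cDyRamDiagonalKappaCountEval (kappaCount_eq_cosetKappa_of_hcoset cosetKappa_coset_eq_of_dichotomy)
open Summit.HodgeConjecture.HodgeConjecture.Cruxes.H413.F0P3cDyRamDiagonalKappaSplitCountEval (chiVec_zero chiVec_one chiVec_two normSign_mul_self)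
open Summit.HodgeConjecture.HodgeConjecture.Cruxes.H413.F0P3cDyRamStableSumSignClasses (normSign_eq_one_or)
open Summit.HodgeConjecture.HodgeConjecture.Cruxes.H413.F0P3cDyRamLabelledOddOneSlotRead
open Summit.HodgeConjecture.HodgeConjecture.Cruxes.H413.F0P3cDyRamLabelledOddOneSlotValueClass
open scoped Valued WithZero Matrix MatrixGroups

variable {K : Type} [Field K] [Valued K ℤᵐ⁰]

/-! ## §1  Three-slot bookkeeping and the unlabelled κ-count of a one-coset orbit -/

omit [Valued K ℤᵐ⁰] in
/-- **`χ_m = ω_i·ω_k` for `{i, k, m} = {0, 1, 2}`**: `chiVec σ m D = normSign σ (D i) * normSign σ (D k)` whenever `i ≠ k`, `m ≠ i`, `m ≠ k`. [cite: LanglandsShelstad1987, §3] -/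
theorem chiVec_eq_normSign_mul_normSign_of_ne (σ : K →+* K) (D : Fin 3 → K) {i k m : Fin 3} (hik : i ≠ k) (hmi : m ≠ i) (hmk : m ≠ k) :
    chiVec σ m D = normSign σ (D i) * normSign σ (D k) := by
  fin_cases i <;> fin_cases k <;> fin_cases m <;> simp_all [chiVec_zero, chiVec_one, chiVec_two] <;> ring

section OneCoset

variable {σ : K →+* K} {ϖ : K} {tv : ℕ} {M₀ : Submodule 𝒪[K] (Fin 3 → K)} {D₁ : Fin 3 → K}

open Classical in
/-- **THE UNLABELLED κ-COUNT OF A ONE-COSET ORBIT** (★ `kappaCount_eq_cosetKappa_of_hcoset` ∘ ★ `cosetKappa_coset_eq_of_dichotomy`, by name):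
`kappaCount σ ϖ tv m M₀ = if (∀ u ∈ S_F(M₀), χ_m(u) = 1) then χ_m(D₁) else 0`. [cite: Kottwitz1986BaseChangeUnits, §1 pp. 240–241] [cite: LanglandsShelstad1987, §3] -/
theorem kappaCount_eq_ite_of_hcoset {c : K} (hσc : σ c = c) (hc : ¬ ∃ z : K, z * σ z = c)
    (hdich : ∀ x : K, σ x = x → x ≠ 0 → (∃ z : K, z * σ z = x) ∨ ∃ z : K, z * σ z = c * x)
    (hD₁ : ∀ j, σ (D₁ j) = D₁ j ∧ D₁ j ≠ 0) (hV₁ : IsVertexLattice σ ϖ (Matrix.diagonal D₁) tv M₀)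
    (hcoset : ∀ D : Fin 3 → K, (∀ j, σ (D j) = D j ∧ D j ≠ 0) →
      (IsVertexLattice σ ϖ (Matrix.diagonal D) tv M₀ ↔ ∃ u ∈ fixedUnitStabilizer σ M₀, ∀ j, D j = D₁ j * ((u j : Kˣ) : K))) (m : Fin 3) :
    kappaCount σ ϖ tv m M₀ = if (∀ u ∈ fixedUnitStabilizer σ M₀, chiVec σ m (fun j => ((u j : Kˣ) : K)) = 1) then chiVec σ m D₁ else 0 := by
  rw [kappaCount_eq_cosetKappa_of_hcoset σ ϖ tv m M₀ hD₁ hV₁ hcoset, cosetKappa_coset_eq_of_dichotomy σ hσc hc hdich m M₀ hD₁]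

/-! ## §2  HEADS (κ1)∕(κ2): the one-slot labelled count as half a κ-count -/

open Classical in
/-- **(κ1) — THE ONE-SLOT LABELLED COUNT IS HALF THE κ-COUNT OF THE THIRD SLOT.**  PART 1 data (`hσ hvσ`; a unit non-norm `c` with the dichotomy; a finite orbit; `D₁·S_F(M₀)` =
the type-`tv` polarisations; a one-slot label `Λ` at slot `k` with sign `ε`); slots `i ≠ k` and `m ∉ {i, k}`.  Then
`labelledOddCount σ ϖ tv i Λ M₀ ∕ [𝒰 : N(S̃′(M₀))] = ε·ω(D_{1,k})∕2 · kappaCount σ ϖ tv m M₀ · stabiliserWeight σ M₀`.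
[cite: Kottwitz1986BaseChangeUnits, §1 pp. 240–241] [cite: LanglandsShelstad1987, §3] [cite: Rogawski1990, §4.10 p. 58] -/
theorem labelledOddCount_div_relIndex_eq_kappaCount_mul_of_oneSlot (hσ : ∀ x, σ (σ x) = x) (hvσ : ∀ a, Valued.v (σ a) = Valued.v a)
    {c : K} (hσc : σ c = c) (hcv : Valued.v c = 1) (hc : ¬ ∃ z : K, z * σ z = c)
    (hdich : ∀ x : K, σ x = x → x ≠ 0 → (∃ z : K, z * σ z = x) ∨ ∃ z : K, z * σ z = c * x)
    (hfin : {M : Submodule 𝒪[K] (Fin 3 → K) | ∃ u ∈ unitTorus K 3, M = mapGL (diagGLUnits u) M₀}.Finite)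
    (hD₁ : ∀ j, σ (D₁ j) = D₁ j ∧ D₁ j ≠ 0) (hV₁ : IsVertexLattice σ ϖ (Matrix.diagonal D₁) tv M₀)
    (hcoset : ∀ D : Fin 3 → K, (∀ j, σ (D j) = D j ∧ D j ≠ 0) →
      (IsVertexLattice σ ϖ (Matrix.diagonal D) tv M₀ ↔ ∃ u ∈ fixedUnitStabilizer σ M₀, ∀ j, D j = D₁ j * ((u j : Kˣ) : K)))
    (Λ : Submodule 𝒪[K] (Fin 3 → K) → (Fin 3 → K) → Prop) {i k m : Fin 3} (hik : i ≠ k) (hmi : m ≠ i) (hmk : m ≠ k) {ε : ℤ} (hε : ε = 1 ∨ ε = -1)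
    (hΛ : ∀ u ∈ fixedUnitStabilizer σ M₀, Λ M₀ (fun j => D₁ j * ((u j : Kˣ) : K)) ↔ ε * normSign σ ((u k : Kˣ) : K) = 1) :
    (labelledOddCount σ ϖ tv i Λ M₀ : ℚ) / ((((unitStabilizer M₀).map (unitNormMap σ 3)).relIndex (fixedUnitTorus σ 3) : ℕ) : ℚ) =
      (ε : ℚ) * (normSign σ (D₁ k) : ℚ) / 2 * (kappaCount σ ϖ tv m M₀ : ℚ) * stabiliserWeight σ M₀ := by
  rw [labelledOddCount_div_relIndex_eq_of_oneSlot hσ hvσ hσc hcv hc hdich hfin hD₁ hV₁ hcoset Λ i k hε hΛ,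
    kappaCount_eq_ite_of_hcoset hσc hc hdich hD₁ hV₁ hcoset m]
  have hiff : (∀ u ∈ fixedUnitStabilizer σ M₀, normSign σ ((u i : Kˣ) : K) * normSign σ ((u k : Kˣ) : K) = 1) ↔
      (∀ u ∈ fixedUnitStabilizer σ M₀, chiVec σ m (fun j => ((u j : Kˣ) : K)) = 1) := by
    refine ⟨fun h u hu => ?_, fun h u hu => ?_⟩
    · rw [chiVec_eq_normSign_mul_normSign_of_ne σ (fun j => ((u j : Kˣ) : K)) hik hmi hmk]; exact h u hu
    · have h2 := h u hu
      rw [chiVec_eq_normSign_mul_normSign_of_ne σ (fun j => ((u j : Kˣ) : K)) hik hmi hmk] at h2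
      exact h2
  have hDk : (normSign σ (D₁ k) : ℚ) * (normSign σ (D₁ k) : ℚ) = 1 := by exact_mod_cast normSign_mul_self σ (D₁ k)
  by_cases h : ∀ u ∈ fixedUnitStabilizer σ M₀, normSign σ ((u i : Kˣ) : K) * normSign σ ((u k : Kˣ) : K) = 1
  · rw [if_pos h, if_pos (hiff.1 h), chiVec_eq_normSign_mul_normSign_of_ne σ D₁ hik hmi hmk]
    push_cast
    linear_combination (-(ε : ℚ) * (normSign σ (D₁ i) : ℚ) / 2 * stabiliserWeight σ M₀) * hDk
  · rw [if_neg h, if_neg (fun h' => h (hiff.2 h'))]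
    push_cast
    ring

/-- **(κ2) — THE READ SLOT ITSELF CARRIES NO κ-FACTOR**: at `i = k`,
`labelledOddCount σ ϖ tv k Λ M₀ ∕ [𝒰 : N(S̃′(M₀))] = ε·ω(D_{1,k})∕2 · stabiliserWeight σ M₀` (`ω(u_k)·ω(u_k) = 1`). [cite: Kottwitz1986BaseChangeUnits, §1 pp. 240–241] [cite: LanglandsShelstad1987, §3] -/
theorem labelledOddCount_div_relIndex_eq_of_oneSlot_same (hσ : ∀ x, σ (σ x) = x) (hvσ : ∀ a, Valued.v (σ a) = Valued.v a)
    {c : K} (hσc : σ c = c) (hcv : Valued.v c = 1) (hc : ¬ ∃ z : K, z * σ z = c)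
    (hdich : ∀ x : K, σ x = x → x ≠ 0 → (∃ z : K, z * σ z = x) ∨ ∃ z : K, z * σ z = c * x)
    (hfin : {M : Submodule 𝒪[K] (Fin 3 → K) | ∃ u ∈ unitTorus K 3, M = mapGL (diagGLUnits u) M₀}.Finite)
    (hD₁ : ∀ j, σ (D₁ j) = D₁ j ∧ D₁ j ≠ 0) (hV₁ : IsVertexLattice σ ϖ (Matrix.diagonal D₁) tv M₀)
    (hcoset : ∀ D : Fin 3 → K, (∀ j, σ (D j) = D j ∧ D j ≠ 0) →
      (IsVertexLattice σ ϖ (Matrix.diagonal D) tv M₀ ↔ ∃ u ∈ fixedUnitStabilizer σ M₀, ∀ j, D j = D₁ j * ((u j : Kˣ) : K)))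
    (Λ : Submodule 𝒪[K] (Fin 3 → K) → (Fin 3 → K) → Prop) (k : Fin 3) {ε : ℤ} (hε : ε = 1 ∨ ε = -1)
    (hΛ : ∀ u ∈ fixedUnitStabilizer σ M₀, Λ M₀ (fun j => D₁ j * ((u j : Kˣ) : K)) ↔ ε * normSign σ ((u k : Kˣ) : K) = 1) :
    (labelledOddCount σ ϖ tv k Λ M₀ : ℚ) / ((((unitStabilizer M₀).map (unitNormMap σ 3)).relIndex (fixedUnitTorus σ 3) : ℕ) : ℚ) =
      (ε : ℚ) * (normSign σ (D₁ k) : ℚ) / 2 * stabiliserWeight σ M₀ := by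
  classical
  rw [labelledOddCount_div_relIndex_eq_of_oneSlot hσ hvσ hσc hcv hc hdich hfin hD₁ hV₁ hcoset Λ k k hε hΛ,
    if_pos (fun u _ => normSign_mul_self σ _)]
  push_cast
  ring

end OneCoset

/-! ## §3  The `valueClassLabel` instances on a one-slot-dominant normalised type-0 orbit -/

section ValueClass

variable {σ : K →+* K} {ϖ : K} {d t : ℕ}

/-- **(κ3) — slot `1` negligible (read on slot `0`), `i ≠ 0`, `m` the third slot**: `M₀ = latt g` normalised, type 0, finite orbit, ★ PART 2 HEAD B data (`hsmall`, `e′`):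
`labelledOddCount σ ϖ 0 i (valueClassLabel σ ϖ x₀ x₁ m* d) M₀ ∕ [𝒰 : N S̃′] = ω(e′)·ω(D_{1,0})∕2 · kappaCount σ ϖ 0 m M₀ · stabiliserWeight σ M₀`.
[cite: Kottwitz1986BaseChangeUnits, §1 pp. 240–241] [cite: Rogawski1990, §4.9 Prop. 4.9.1 (a)(b) p. 55] [cite: LanglandsShelstad1987, §3] -/
theorem labelledOddCount_valueClassLabel_div_relIndex_eq_kappaCount_mul_of_snd_small [IsAdicComplete 𝓂[K] 𝒪[K]] (hD : IsRamifiedQuadraticDatum σ ϖ d t)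
    {c : K} (hσc : σ c = c) (hcv : Valued.v c = 1) (hc : ¬ ∃ z : K, z * σ z = c)
    (hdich : ∀ x : K, σ x = x → x ≠ 0 → (∃ z : K, z * σ z = x) ∨ ∃ z : K, z * σ z = c * x)
    (x₀ x₁ : K) (g : GL (Fin 3) K) {M₀ : Submodule 𝒪[K] (Fin 3 → K)} (hM₀ : M₀ = latt (g : Matrix (Fin 3) (Fin 3) K)) (hnorm : IsNormalisedLattice M₀)
    (hfin : {M : Submodule 𝒪[K] (Fin 3 → K) | ∃ u ∈ unitTorus K 3, M = mapGL (diagGLUnits u) M₀}.Finite)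
    {D₁ : Fin 3 → K} (hD₁ : ∀ j, σ (D₁ j) = D₁ j ∧ D₁ j ≠ 0) (hV₁ : IsVertexLattice σ ϖ (Matrix.diagonal D₁) 0 M₀)
    (hsmall : ∀ y ∈ M₀, Valued.v ((ϖ ^ (d % 2 + 2 * d - 1))⁻¹ * (D₁ 1 * x₁ * (y 1 * σ (y 1)))) ≤ 1)
    {e' : K} (hσe' : σ e' = e') (he'1 : Valued.v e' = 1)
    (hee : Valued.v ((ϖ ^ (d % 2 + 2 * d - 1))⁻¹ * (D₁ 0 * x₀ - e' * ((ϖ - σ ϖ) * ((ϖ * σ ϖ) ^ ((d - d % 2) / 2))⁻¹))) ≤ 1)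
    {i m : Fin 3} (hi0 : i ≠ 0) (hmi : m ≠ i) (hm0 : m ≠ 0) :
    (labelledOddCount σ ϖ 0 i (valueClassLabel σ ϖ x₀ x₁ (d % 2 + 2 * d - 1) d) M₀ : ℚ) /
        ((((unitStabilizer M₀).map (unitNormMap σ 3)).relIndex (fixedUnitTorus σ 3) : ℕ) : ℚ) =
      (normSign σ e' : ℚ) * (normSign σ (D₁ 0) : ℚ) / 2 * (kappaCount σ ϖ 0 m M₀ : ℚ) * stabiliserWeight σ M₀ := by
  have hσ := hD.1; have hvσ := hD.2.1
  exact labelledOddCount_div_relIndex_eq_kappaCount_mul_of_oneSlot hσ hvσ hσc hcv hc hdich hfin hD₁ hV₁ (fibre_isCoset_zero hvσ ϖ g hM₀ hnorm D₁ hD₁ hV₁)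
    (valueClassLabel σ ϖ x₀ x₁ (d % 2 + 2 * d - 1) d) hi0 hmi hm0 (normSign_eq_one_or σ e')
    (fun u hu => valueClassLabel_mul_iff_of_snd_small hD hσc hc hdich x₀ x₁ (g : Matrix (Fin 3) (Fin 3) K) hM₀ hnorm
      (fun y hy => hsmall y (hM₀ ▸ hy)) hσe' he'1 hee hu)

/-- **(κ3′) — slot `1` negligible, the read slot `i = 0` itself**:
`labelledOddCount σ ϖ 0 0 (valueClassLabel σ ϖ x₀ x₁ m* d) M₀ ∕ [𝒰 : N S̃′] = ω(e′)·ω(D_{1,0})∕2 · stabiliserWeight σ M₀`. [cite: Kottwitz1986BaseChangeUnits, §1 pp. 240–241] [cite: LanglandsShelstad1987, §3] -/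
theorem labelledOddCount_valueClassLabel_div_relIndex_eq_of_snd_small_zero [IsAdicComplete 𝓂[K] 𝒪[K]] (hD : IsRamifiedQuadraticDatum σ ϖ d t)
    {c : K} (hσc : σ c = c) (hcv : Valued.v c = 1) (hc : ¬ ∃ z : K, z * σ z = c)
    (hdich : ∀ x : K, σ x = x → x ≠ 0 → (∃ z : K, z * σ z = x) ∨ ∃ z : K, z * σ z = c * x)
    (x₀ x₁ : K) (g : GL (Fin 3) K) {M₀ : Submodule 𝒪[K] (Fin 3 → K)} (hM₀ : M₀ = latt (g : Matrix (Fin 3) (Fin 3) K)) (hnorm : IsNormalisedLattice M₀)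
    (hfin : {M : Submodule 𝒪[K] (Fin 3 → K) | ∃ u ∈ unitTorus K 3, M = mapGL (diagGLUnits u) M₀}.Finite)
    {D₁ : Fin 3 → K} (hD₁ : ∀ j, σ (D₁ j) = D₁ j ∧ D₁ j ≠ 0) (hV₁ : IsVertexLattice σ ϖ (Matrix.diagonal D₁) 0 M₀)
    (hsmall : ∀ y ∈ M₀, Valued.v ((ϖ ^ (d % 2 + 2 * d - 1))⁻¹ * (D₁ 1 * x₁ * (y 1 * σ (y 1)))) ≤ 1)
    {e' : K} (hσe' : σ e' = e') (he'1 : Valued.v e' = 1)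
    (hee : Valued.v ((ϖ ^ (d % 2 + 2 * d - 1))⁻¹ * (D₁ 0 * x₀ - e' * ((ϖ - σ ϖ) * ((ϖ * σ ϖ) ^ ((d - d % 2) / 2))⁻¹))) ≤ 1) :
    (labelledOddCount σ ϖ 0 0 (valueClassLabel σ ϖ x₀ x₁ (d % 2 + 2 * d - 1) d) M₀ : ℚ) /
        ((((unitStabilizer M₀).map (unitNormMap σ 3)).relIndex (fixedUnitTorus σ 3) : ℕ) : ℚ) =
      (normSign σ e' : ℚ) * (normSign σ (D₁ 0) : ℚ) / 2 * stabiliserWeight σ M₀ := by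
  have hσ := hD.1; have hvσ := hD.2.1
  exact labelledOddCount_div_relIndex_eq_of_oneSlot_same hσ hvσ hσc hcv hc hdich hfin hD₁ hV₁ (fibre_isCoset_zero hvσ ϖ g hM₀ hnorm D₁ hD₁ hV₁)
    (valueClassLabel σ ϖ x₀ x₁ (d % 2 + 2 * d - 1) d) 0 (normSign_eq_one_or σ e')
    (fun u hu => valueClassLabel_mul_iff_of_snd_small hD hσc hc hdich x₀ x₁ (g : Matrix (Fin 3) (Fin 3) K) hM₀ hnorm
      (fun y hy => hsmall y (hM₀ ▸ hy)) hσe' he'1 hee hu)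

/-- **(κ4) — slot `0` negligible (read on slot `1`), `i ≠ 1`, `m` the third slot**:
`labelledOddCount σ ϖ 0 i (valueClassLabel σ ϖ x₀ x₁ m* d) M₀ ∕ [𝒰 : N S̃′] = ω(e′)·ω(D_{1,1})∕2 · kappaCount σ ϖ 0 m M₀ · stabiliserWeight σ M₀`.
[cite: Kottwitz1986BaseChangeUnits, §1 pp. 240–241] [cite: Rogawski1990, §4.9 Prop. 4.9.1 (a)(b) p. 55] [cite: LanglandsShelstad1987, §3] -/
theorem labelledOddCount_valueClassLabel_div_relIndex_eq_kappaCount_mul_of_fst_small [IsAdicComplete 𝓂[K] 𝒪[K]] (hD : IsRamifiedQuadraticDatum σ ϖ d t)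
    {c : K} (hσc : σ c = c) (hcv : Valued.v c = 1) (hc : ¬ ∃ z : K, z * σ z = c)
    (hdich : ∀ x : K, σ x = x → x ≠ 0 → (∃ z : K, z * σ z = x) ∨ ∃ z : K, z * σ z = c * x)
    (x₀ x₁ : K) (g : GL (Fin 3) K) {M₀ : Submodule 𝒪[K] (Fin 3 → K)} (hM₀ : M₀ = latt (g : Matrix (Fin 3) (Fin 3) K)) (hnorm : IsNormalisedLattice M₀)
    (hfin : {M : Submodule 𝒪[K] (Fin 3 → K) | ∃ u ∈ unitTorus K 3, M = mapGL (diagGLUnits u) M₀}.Finite)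
    {D₁ : Fin 3 → K} (hD₁ : ∀ j, σ (D₁ j) = D₁ j ∧ D₁ j ≠ 0) (hV₁ : IsVertexLattice σ ϖ (Matrix.diagonal D₁) 0 M₀)
    (hsmall : ∀ y ∈ M₀, Valued.v ((ϖ ^ (d % 2 + 2 * d - 1))⁻¹ * (D₁ 0 * x₀ * (y 0 * σ (y 0)))) ≤ 1)
    {e' : K} (hσe' : σ e' = e') (he'1 : Valued.v e' = 1)
    (hee : Valued.v ((ϖ ^ (d % 2 + 2 * d - 1))⁻¹ * (D₁ 1 * x₁ - e' * ((ϖ - σ ϖ) * ((ϖ * σ ϖ) ^ ((d - d % 2) / 2))⁻¹))) ≤ 1)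
    {i m : Fin 3} (hi1 : i ≠ 1) (hmi : m ≠ i) (hm1 : m ≠ 1) :
    (labelledOddCount σ ϖ 0 i (valueClassLabel σ ϖ x₀ x₁ (d % 2 + 2 * d - 1) d) M₀ : ℚ) /
        ((((unitStabilizer M₀).map (unitNormMap σ 3)).relIndex (fixedUnitTorus σ 3) : ℕ) : ℚ) =
      (normSign σ e' : ℚ) * (normSign σ (D₁ 1) : ℚ) / 2 * (kappaCount σ ϖ 0 m M₀ : ℚ) * stabiliserWeight σ M₀ := by
  have hσ := hD.1; have hvσ := hD.2.1
  exact labelledOddCount_div_relIndex_eq_kappaCount_mul_of_oneSlot hσ hvσ hσc hcv hc hdich hfin hD₁ hV₁ (fibre_isCoset_zero hvσ ϖ g hM₀ hnorm D₁ hD₁ hV₁)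
    (valueClassLabel σ ϖ x₀ x₁ (d % 2 + 2 * d - 1) d) hi1 hmi hm1 (normSign_eq_one_or σ e')
    (fun u hu => valueClassLabel_mul_iff_of_fst_small hD hσc hc hdich x₀ x₁ (g : Matrix (Fin 3) (Fin 3) K) hM₀ hnorm
      (fun y hy => hsmall y (hM₀ ▸ hy)) hσe' he'1 hee hu)

/-- **(κ4′) — slot `0` negligible, the read slot `i = 1` itself**:
`labelledOddCount σ ϖ 0 1 (valueClassLabel σ ϖ x₀ x₁ m* d) M₀ ∕ [𝒰 : N S̃′] = ω(e′)·ω(D_{1,1})∕2 · stabiliserWeight σ M₀`. [cite: Kottwitz1986BaseChangeUnits, §1 pp. 240–241] [cite: LanglandsShelstad1987, §3] -/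
theorem labelledOddCount_valueClassLabel_div_relIndex_eq_of_fst_small_one [IsAdicComplete 𝓂[K] 𝒪[K]] (hD : IsRamifiedQuadraticDatum σ ϖ d t)
    {c : K} (hσc : σ c = c) (hcv : Valued.v c = 1) (hc : ¬ ∃ z : K, z * σ z = c)
    (hdich : ∀ x : K, σ x = x → x ≠ 0 → (∃ z : K, z * σ z = x) ∨ ∃ z : K, z * σ z = c * x)
    (x₀ x₁ : K) (g : GL (Fin 3) K) {M₀ : Submodule 𝒪[K] (Fin 3 → K)} (hM₀ : M₀ = latt (g : Matrix (Fin 3) (Fin 3) K)) (hnorm : IsNormalisedLattice M₀)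
    (hfin : {M : Submodule 𝒪[K] (Fin 3 → K) | ∃ u ∈ unitTorus K 3, M = mapGL (diagGLUnits u) M₀}.Finite)
    {D₁ : Fin 3 → K} (hD₁ : ∀ j, σ (D₁ j) = D₁ j ∧ D₁ j ≠ 0) (hV₁ : IsVertexLattice σ ϖ (Matrix.diagonal D₁) 0 M₀)
    (hsmall : ∀ y ∈ M₀, Valued.v ((ϖ ^ (d % 2 + 2 * d - 1))⁻¹ * (D₁ 0 * x₀ * (y 0 * σ (y 0)))) ≤ 1)
    {e' : K} (hσe' : σ e' = e') (he'1 : Valued.v e' = 1)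
    (hee : Valued.v ((ϖ ^ (d % 2 + 2 * d - 1))⁻¹ * (D₁ 1 * x₁ - e' * ((ϖ - σ ϖ) * ((ϖ * σ ϖ) ^ ((d - d % 2) / 2))⁻¹))) ≤ 1) :
    (labelledOddCount σ ϖ 0 1 (valueClassLabel σ ϖ x₀ x₁ (d % 2 + 2 * d - 1) d) M₀ : ℚ) /
        ((((unitStabilizer M₀).map (unitNormMap σ 3)).relIndex (fixedUnitTorus σ 3) : ℕ) : ℚ) =
      (normSign σ e' : ℚ) * (normSign σ (D₁ 1) : ℚ) / 2 * stabiliserWeight σ M₀ := by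
  have hσ := hD.1; have hvσ := hD.2.1
  exact labelledOddCount_div_relIndex_eq_of_oneSlot_same hσ hvσ hσc hcv hc hdich hfin hD₁ hV₁ (fibre_isCoset_zero hvσ ϖ g hM₀ hnorm D₁ hD₁ hV₁)
    (valueClassLabel σ ϖ x₀ x₁ (d % 2 + 2 * d - 1) d) 1 (normSign_eq_one_or σ e')
    (fun u hu => valueClassLabel_mul_iff_of_fst_small hD hσc hc hdich x₀ x₁ (g : Matrix (Fin 3) (Fin 3) K) hM₀ hnorm
      (fun y hy => hsmall y (hM₀ ▸ hy)) hσe' he'1 hee hu)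

end ValueClass

end Summit.HodgeConjecture.HodgeConjecture.Cruxes.H413.F0P3cDyRamLabelledOddOneSlotKappa

end
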